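import Mathlib
import Summits.AtomisticToContinuum.HydrodynamicLimit.Theorems.InformationPercolationEngineKickFairRelEquilibriumMesoReductionB2
import Summits.AtomisticToContinuum.HydrodynamicLimit.Theorems.InformationPercolationEngineKickFairRelEquilibriumMesoSingleKickBiasNecessary
import HarnessLib

/-!
# `KickFairRelEquilibriumMeso`, line `condition-the-past` — B2′ ⟹ B2″:
# `pairCondCov_of_pairInnovationBias : PairInnovationBias rs → PairCondCov rs`

Prover file (`--supports stmt-AtomisticToContinuum-15177`, wave 2, lead c7) for the registered sub-goal
`pairCondCov_of_pairInnovationBias` (`…ConditionThePastDefs`, rev 2) of the line `condition-the-past` of the crux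
`Summit.AtomisticToContinuum.HydrodynamicLimit.Theses.InformationPercolationEngine.KickFairRelEquilibriumMeso`: the pair
conditional COVARIANCE statement B2″ (`PairCondCov`: `Γ = E_{LG}[ξ_c ξ_{c'} | σ(P_c, P_{c'})]`, `ξ = D − β`) follows from the
pair INNOVATION statement B2′ (`PairInnovationBias`: `|β₂(c → c') − β_{c'}|`), with `σ₀ := min σ₀ (1/2)` and B2″ at `δ` from
B2′ at `δ/(4C+1)`. Fixed `N` (`σ ≤ 1/2`, `|g| ≤ C`, so `|ξ| ≤ 4C` a.e.):
* TOWER (`integral_vvo_abs_pairCondCovLG_le`): the join `σ(P_c, P_{c'})` (`joinSA`) lies inside the enriched σ-algebra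
  `σ(P_{c'}, P_c, D_c)` (`pairSA`), for which `ξ_c` is measurable and `E_{LG}[ξ_{c'} | pairSA] = β₂ − β_{c'}`; hence
  `Γ = E_{LG}[ξ_c (β₂ − β_{c'}) | join]` a.e., `|Γ| ≤ E_{LG}[|ξ_c| |β₂ − β_{c'}| | join]` a.e., and against the bounded
  join-measurable indicator `1_{v_c} 1_{v_{c'}} 1_{c ≺ c'}` (pull-out, `integral_condExp`) `∫ 1 |Γ| ≤ 4C ∫ 1 |β₂ − β_{c'}|`.
* TRUNCATION (`lintegral_pairCondCov_le_of_innovation`): the random index ranges `n < cnt_i` are a.e. the validity events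
  read off the pasts (`ae_forall_lt_cnt_iff_pastTime`), so the ordered pair sum truncated at `n, n' < M` (`truncPairSum`) is
  a.e. a FINITE family sum of the above integrands (`famSum_eq_truncPairSum`); its integral is `≤ 4C` times the B2′ family
  sum, dominated by the full B2′ integrand (`pairSum_ordered_le`); then `M → ∞` by monotone convergence.
-/

noncomputable section

open MeasureTheory Set Filter Topology
open scoped ENNReal Classical

namespace Summit.AtomisticToContinuum.HydrodynamicLimit.Theorems.KickFairRelEquilibriumMesoLine

open Literature.Analysis.FluidPDE Literature.MathematicalPhysics.KineticTheory

variable {σ : ℝ} {N : ℕ}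

/-! ## The join of two pasts inside the enriched σ-algebra; the truncated ordered pair sum -/

/-- `σ(P_c, P_{c'}) ≤ σ(P_{c'}, P_c, D_c)`: the pair of pasts is a measurable function of the enrichment triple. [folklore] -/
theorem joinSA_le_pairSA (Φ : Flow σ N) (r : ℝ) (g : V3 × V3 × V3 → ℝ) (i : Fin (N + 1)) (n : ℕ)
    (i' : Fin (N + 1)) (n' : ℕ) : joinSA Φ r i n i' n' ≤ pairSA Φ r g i n i' n' := by
  have h : (fun z : Phase N => (past Φ r z i n, past Φ r z i' n')) =
      (fun t : Past N × Past N × ℝ => (t.2.1, t.1)) ∘ tripleMap Φ r g i n i' n' := rfl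
  unfold joinSA pairSA
  rw [h, ← MeasurableSpace.comap_comp]
  exact MeasurableSpace.comap_mono (measurable_snd.fst.prodMk measurable_fst).comap_le

/-- The event `v_c ∩ v_{c'} ∩ {c ≺ c'}` (both collisions valid, time-ordered) is measurable for the join. [folklore] -/
theorem measurableSet_vvo_joinSA (Φ : Flow σ N) (τ r : ℝ) (i : Fin (N + 1)) (n : ℕ) (i' : Fin (N + 1)) (n' : ℕ) :
    MeasurableSet[joinSA Φ r i n i' n'] (validEv Φ τ r i n ∩ validEv Φ τ r i' n' ∩ ordEv Φ r i n i' n') :=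
  ((pastSA_le_joinSA_left Φ r i n i' n' _ (measurableSet_validEv Φ r τ i n)).inter
    (pastSA_le_joinSA_right Φ r i n i' n' _ (measurableSet_validEv Φ r τ i' n'))).inter
      (measurableSet_ordEv_joinSA Φ r i n i' n')

/-- The ordered pair sum of `|F|` with both collision indices truncated at `M`:
`Σ_i Σ_{n<cnt_i} Σ_{i'} Σ_{n'<cnt_{i'}} 1_{n<M} 1_{n'<M} 1_{(i,n) ≺ (i',n')} |F|` (monotone in `M`, eventually the full sum). -/
def truncPairSum (Φ : Flow σ N) (τ r : ℝ) (F : Fin (N + 1) → ℕ → Fin (N + 1) → ℕ → Phase N → ℝ) (M : ℕ)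
    (z : Phase N) : ℝ :=
  ∑ i : Fin (N + 1), ∑ n ∈ Finset.range (cnt Φ τ z i), ∑ i' : Fin (N + 1), ∑ n' ∈ Finset.range (cnt Φ τ z i'),
    (if n < M then (1 : ℝ) else 0) * ((if n' < M then (1 : ℝ) else 0) *
      ((if Precedes (past Φ r z i n) (past Φ r z i' n') then (1 : ℝ) else 0) * |F i n i' n' z|))

/-- `truncPairSum` is monotone in the truncation level (nonnegative terms). [folklore] -/
theorem truncPairSum_mono (Φ : Flow σ N) (τ r : ℝ) (F : Fin (N + 1) → ℕ → Fin (N + 1) → ℕ → Phase N → ℝ)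
    (z : Phase N) : Monotone fun M => truncPairSum Φ τ r F M z := by
  intro M M' hMM'
  refine Finset.sum_le_sum fun i _ => Finset.sum_le_sum fun n _ => Finset.sum_le_sum fun i' _ =>
    Finset.sum_le_sum fun n' _ => ?_
  have hX : 0 ≤ (if Precedes (past Φ r z i n) (past Φ r z i' n') then (1 : ℝ) else 0) * |F i n i' n' z| := by
    positivity
  by_cases h1 : n < M
  · by_cases h2 : n' < M
    · rw [if_pos h1, if_pos h2, if_pos (h1.trans_le hMM'), if_pos (h2.trans_le hMM')]
    · rw [if_neg h2, zero_mul, mul_zero]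
      exact mul_nonneg (by positivity) (mul_nonneg (by positivity) hX)
  · rw [if_neg h1, zero_mul]
    exact mul_nonneg (by positivity) (mul_nonneg (by positivity) hX)

/-- Beyond the largest collision count the truncation is void: `truncPairSum … M z` is the full ordered pair sum. [folklore] -/
theorem truncPairSum_eq_of_sup_le (Φ : Flow σ N) (τ r : ℝ) (F : Fin (N + 1) → ℕ → Fin (N + 1) → ℕ → Phase N → ℝ)
    (z : Phase N) {M : ℕ} (hM : Finset.univ.sup (cnt Φ τ z) ≤ M) :
    truncPairSum Φ τ r F M z = ∑ i : Fin (N + 1), ∑ n ∈ Finset.range (cnt Φ τ z i),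
      ∑ i' : Fin (N + 1), ∑ n' ∈ Finset.range (cnt Φ τ z i'),
        (if Precedes (past Φ r z i n) (past Φ r z i' n') then (1 : ℝ) else 0) * |F i n i' n' z| := by
  refine Finset.sum_congr rfl fun i _ => Finset.sum_congr rfl fun n hn => Finset.sum_congr rfl fun i' _ =>
    Finset.sum_congr rfl fun n' hn' => ?_
  rw [if_pos (lt_of_lt_of_le (Finset.mem_range.1 hn) ((Finset.le_sup (Finset.mem_univ i)).trans hM)),
    if_pos (lt_of_lt_of_le (Finset.mem_range.1 hn') ((Finset.le_sup (Finset.mem_univ i')).trans hM)), one_mul, one_mul]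

/-- One truncated cut sum in the two indexings: `Σ_{n<c} 1_{n<M} a_n = Σ_{n : Fin M} 1_{n<c} a_n`. [folklore] -/
theorem sum_range_trunc_eq_sum_fin (a : ℕ → ℝ) (c M : ℕ) :
    ∑ n ∈ Finset.range c, (if n < M then (1 : ℝ) else 0) * a n =
      ∑ n : Fin M, (if (n : ℕ) < c then (1 : ℝ) else 0) * a n := by
  rw [sum_range_ite_lt_comm a c M, Fin.sum_univ_eq_sum_range (fun n => (if n < c then (1 : ℝ) else 0) * a n) M]

/-- Reindexing the doubly truncated pair sum over the finite family `ι × Fin M`: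
`Σ_i Σ_{n<cnt_i} Σ_{i'} Σ_{n'<cnt_{i'}} 1_{n<M} 1_{n'<M} S = Σ_{k} Σ_{l} 1_{k.2<cnt_{k.1}} 1_{l.2<cnt_{l.1}} S`. [folklore] -/
theorem sum_cut_trunc_eq_sum_prod_fin {ι : Type*} [Fintype ι] (cnt : ι → ℕ) (M : ℕ) (S : ι → ℕ → ι → ℕ → ℝ) :
    ∑ i, ∑ n ∈ Finset.range (cnt i), ∑ i', ∑ n' ∈ Finset.range (cnt i'),
        (if n < M then (1 : ℝ) else 0) * ((if n' < M then (1 : ℝ) else 0) * S i n i' n') =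
      ∑ k : ι × Fin M, ∑ l : ι × Fin M, (if (k.2 : ℕ) < cnt k.1 then (1 : ℝ) else 0) *
        ((if (l.2 : ℕ) < cnt l.1 then (1 : ℝ) else 0) * S k.1 k.2 l.1 l.2) := by
  have h1 : ∀ i n, ∑ i', ∑ n' ∈ Finset.range (cnt i'),
      (if n < M then (1 : ℝ) else 0) * ((if n' < M then (1 : ℝ) else 0) * S i n i' n') =
      (if n < M then (1 : ℝ) else 0) * ∑ i', ∑ n' : Fin M, (if (n' : ℕ) < cnt i' then (1 : ℝ) else 0) * S i n i' n' := by
    intro i n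
    rw [Finset.mul_sum]
    refine Finset.sum_congr rfl fun i' _ => ?_
    rw [← Finset.mul_sum, sum_range_trunc_eq_sum_fin (fun n' => S i n i' n') (cnt i') M]
  calc _ = ∑ i, ∑ n ∈ Finset.range (cnt i), (if n < M then (1 : ℝ) else 0) *
          ∑ i', ∑ n' : Fin M, (if (n' : ℕ) < cnt i' then (1 : ℝ) else 0) * S i n i' n' :=
        Finset.sum_congr rfl fun i _ => Finset.sum_congr rfl fun n _ => h1 i n
    _ = ∑ i, ∑ n : Fin M, (if (n : ℕ) < cnt i then (1 : ℝ) else 0) *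
          ∑ i', ∑ n' : Fin M, (if (n' : ℕ) < cnt i' then (1 : ℝ) else 0) * S i n i' n' :=
        Finset.sum_congr rfl fun i _ => sum_range_trunc_eq_sum_fin
          (fun n => ∑ i', ∑ n' : Fin M, (if (n' : ℕ) < cnt i' then (1 : ℝ) else 0) * S i n i' n') (cnt i) M
    _ = ∑ k : ι × Fin M, ∑ l : ι × Fin M, (if (k.2 : ℕ) < cnt k.1 then (1 : ℝ) else 0) *
          ((if (l.2 : ℕ) < cnt l.1 then (1 : ℝ) else 0) * S k.1 k.2 l.1 l.2) := by
        rw [Fintype.sum_prod_type]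
        refine Finset.sum_congr rfl fun i _ => Finset.sum_congr rfl fun n _ => ?_
        rw [Fintype.sum_prod_type, Finset.mul_sum]
        exact Finset.sum_congr rfl fun i' _ => by rw [Finset.mul_sum]

/-- **The truncated ordered pair sum is a finite family sum, where the cut is genuine**: with the validity events
in place of the random index ranges, `truncPairSum … F M z = Σ_{k,l : Fin (N+1) × Fin M} 1_{v_k ∩ v_l ∩ o_{kl}}(z) |F_{kl}(z)|`. [folklore] -/
theorem famSum_eq_truncPairSum (Φ : Flow σ N) (τ r : ℝ) (F : Fin (N + 1) → ℕ → Fin (N + 1) → ℕ → Phase N → ℝ)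
    (M : ℕ) {z : Phase N}
    (hz : ∀ (i : Fin (N + 1)) (n : ℕ), n < cnt Φ τ z i ↔ (past Φ r z i n).2.2.2 ∈ Set.Ioc 0 τ) :
    ∑ k : Fin (N + 1) × Fin M, ∑ l : Fin (N + 1) × Fin M,
        (validEv Φ τ r k.1 k.2 ∩ validEv Φ τ r l.1 l.2 ∩ ordEv Φ r k.1 k.2 l.1 l.2).indicator
          (fun _ => (1 : ℝ)) z * |F k.1 k.2 l.1 l.2 z| = truncPairSum Φ τ r F M z := by
  unfold truncPairSum
  rw [sum_cut_trunc_eq_sum_prod_fin]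
  refine Fintype.sum_congr _ _ fun k => Fintype.sum_congr _ _ fun l => ?_
  by_cases hk : (past Φ r z k.1 k.2).2.2.2 ∈ Set.Ioc 0 τ <;>
    by_cases hl : (past Φ r z l.1 l.2).2.2.2 ∈ Set.Ioc 0 τ <;>
      by_cases hp : Precedes (past Φ r z k.1 k.2) (past Φ r z l.1 l.2) <;>
        simp only [validEv, ordEv, Set.indicator_apply, Set.mem_inter_iff, Set.mem_preimage, Set.mem_setOf_eq,
          hz, hk, hl, hp, and_true, and_false, and_self, if_true, if_false, one_mul, zero_mul]

/-! ## The tower step for one ordered pair, and the estimate at fixed `N` -/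

section FixedN

variable {a₀ θ₀ : T3 → ℝ} {u₀ : T3 → V3}

/-- **Tower bound for one ordered pair.** Under a finite local Gibbs law with `σ ≤ 1/2` and `|g| ≤ C`: against the
indicator of `v_c ∩ v_{c'} ∩ {c ≺ c'}` (a bounded, join-measurable weight), `∫ 1 · |Γ(c, c')| ≤ 4C ∫ 1 · |β₂(c → c') − β_{c'}|`.
Indeed `join ≤ pairSA`, `ξ_c = D_c − β_c` is `pairSA`-measurable and `E[ξ_{c'} | pairSA] = β₂ − β_{c'}`, so
`Γ = E[ξ_c (β₂ − β_{c'}) | join]` a.e., `|Γ| ≤ E[|ξ_c| |β₂ − β_{c'}| | join]` a.e., `|ξ_c| ≤ 4C` a.e., and the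
join-measurable indicator passes through the conditional expectation. [folklore] -/
theorem integral_vvo_abs_pairCondCovLG_le (hσ2 : σ ≤ 1 / 2) (Φ : Flow σ N)
    [IsFiniteMeasure (localGibbsLaw σ a₀ u₀ θ₀ N Φ)] (τ r : ℝ) {g : V3 × V3 × V3 → ℝ} (hg : Continuous g)
    {C : ℝ} (hC : ∀ p, |g p| ≤ C) (i : Fin (N + 1)) (n : ℕ) (i' : Fin (N + 1)) (n' : ℕ) :
    ∫ z, (validEv Φ τ r i n ∩ validEv Φ τ r i' n' ∩ ordEv Φ r i n i' n').indicator (fun _ => (1 : ℝ)) z *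
        |pairCondCovLG σ a₀ θ₀ u₀ Φ r g i n i' n' z| ∂(localGibbsLaw σ a₀ u₀ θ₀ N Φ) ≤
      4 * C * ∫ z, (validEv Φ τ r i n ∩ validEv Φ τ r i' n' ∩ ordEv Φ r i n i' n').indicator (fun _ => (1 : ℝ)) z *
        |betaLG2 σ a₀ θ₀ u₀ Φ r g i n i' n' z - betaLG σ a₀ θ₀ u₀ Φ r g i' n' z| ∂(localGibbsLaw σ a₀ u₀ θ₀ N Φ) := by
  set LG := localGibbsLaw σ a₀ u₀ θ₀ N Φ with hLG
  set I : Phase N → ℝ := (validEv Φ τ r i n ∩ validEv Φ τ r i' n' ∩ ordEv Φ r i n i' n').indicator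
    (fun _ => (1 : ℝ)) with hI
  set D : Phase N → ℝ := kickDev Φ r g i n with hD
  set D' : Phase N → ℝ := kickDev Φ r g i' n' with hD'
  set β : Phase N → ℝ := betaLG σ a₀ θ₀ u₀ Φ r g i n with hβ
  set β' : Phase N → ℝ := betaLG σ a₀ θ₀ u₀ Φ r g i' n' with hβ'
  set β₂ : Phase N → ℝ := betaLG2 σ a₀ θ₀ u₀ Φ r g i n i' n' with hβ₂
  set ξ : Phase N → ℝ := fun z => D z - β z with hξ
  set ξ' : Phase N → ℝ := fun z => D' z - β' z with hξ'
  set H : Phase N → ℝ := fun z => ξ z * (β₂ z - β' z) with hH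
  have hC0 : 0 ≤ C := (abs_nonneg _).trans (hC 0)
  -- the σ-algebras `join ≤ pairSA ≤ Borel`
  have hmA : pairSA Φ r g i n i' n' ≤ (inferInstance : MeasurableSpace (Phase N)) := pairSA_le Φ r hg i n i' n'
  have hm : joinSA Φ r i n i' n' ≤ (inferInstance : MeasurableSpace (Phase N)) := joinSA_le Φ r i n i' n'
  -- a.e. bounds, measurability, integrability of the ingredients
  have haeD := ae_forall_abs_kickDev_le (a₀ := a₀) (θ₀ := θ₀) (u₀ := u₀) hσ2 Φ r hC
  have haeβ := ae_forall_abs_betaLG_le (a₀ := a₀) (θ₀ := θ₀) (u₀ := u₀) hσ2 Φ r hC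
  have haeβ₂ := ae_forall_abs_betaLG2_le (a₀ := a₀) (θ₀ := θ₀) (u₀ := u₀) hσ2 Φ r hC
  have hξb : ∀ᵐ z ∂LG, |ξ z| ≤ 4 * C := by
    filter_upwards [haeD, haeβ] with z h1 h2
    exact (abs_sub _ _).trans (by linarith [h1 i n, h2 i n])
  have hξ'b : ∀ᵐ z ∂LG, |ξ' z| ≤ 4 * C := by
    filter_upwards [haeD, haeβ] with z h1 h2
    exact (abs_sub _ _).trans (by linarith [h1 i' n', h2 i' n'])
  have hΔb : ∀ᵐ z ∂LG, |β₂ z - β' z| ≤ 4 * C := by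
    filter_upwards [haeβ, haeβ₂] with z h1 h2
    exact (abs_sub _ _).trans (by linarith [h2 i n i' n', h1 i' n'])
  have hξm : Measurable ξ := (measurable_kickDev Φ r hg i n).sub (measurable_betaLG_borel Φ r g i n)
  have hξ'm : Measurable ξ' := (measurable_kickDev Φ r hg i' n').sub (measurable_betaLG_borel Φ r g i' n')
  have hD'i : Integrable D' LG :=
    integrable_of_ae_abs_le (measurable_kickDev Φ r hg i' n').aestronglyMeasurable (haeD.mono fun z hz => hz i' n')
  have hβ'i : Integrable β' LG := integrable_condExp
  have hξ'i : Integrable ξ' LG := hD'i.sub hβ'i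
  have hξξ'i : Integrable (ξ * ξ') LG := by
    refine integrable_of_ae_abs_le (hξm.mul hξ'm).aestronglyMeasurable (B := 4 * C * (4 * C)) ?_
    filter_upwards [hξb, hξ'b] with z h1 h2
    rw [Pi.mul_apply, abs_mul]
    exact mul_le_mul h1 h2 (abs_nonneg _) ((abs_nonneg _).trans h1)
  have hHb : ∀ᵐ z ∂LG, |H z| ≤ 4 * C * |β₂ z - β' z| := by
    filter_upwards [hξb] with z h1
    rw [hH, abs_mul]
    exact mul_le_mul_of_nonneg_right h1 (abs_nonneg _)
  have hHi : Integrable H LG := by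
    refine integrable_of_ae_abs_le (hξm.mul ((measurable_betaLG2 Φ r hg i n i' n').sub
      (measurable_betaLG_borel Φ r g i' n'))).aestronglyMeasurable (B := 4 * C * (4 * C)) ?_
    filter_upwards [hHb, hΔb] with z h1 h2
    exact h1.trans (mul_le_mul_of_nonneg_left h2 (by positivity))
  -- Step 1 (pull-out on the enriched σ-algebra): `E[ξ ξ' | pairSA] = ξ (β₂ − β') = H` a.e.
  have hξsm : StronglyMeasurable[pairSA Φ r g i n i' n'] ξ :=
    (stronglyMeasurable_kickDev_pairSA Φ r g i n i' n').sub
      ((stronglyMeasurable_condExp : StronglyMeasurable[pastSA Φ r i n] β).mono (pastSA_le_pairSA_left Φ r g i n i' n'))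
  have hβ'sm : StronglyMeasurable[pairSA Φ r g i n i' n'] β' :=
    (stronglyMeasurable_condExp : StronglyMeasurable[pastSA Φ r i' n'] β').mono (pastSA_le_pairSA_right Φ r g i n i' n')
  have h1 : LG[ξ * ξ' | pairSA Φ r g i n i' n'] =ᵐ[LG] ξ * LG[ξ' | pairSA Φ r g i n i' n'] :=
    condExp_mul_of_stronglyMeasurable_left hξsm hξξ'i hξ'i
  have h2 : LG[ξ' | pairSA Φ r g i n i' n'] =ᵐ[LG] fun z => β₂ z - β' z := by
    filter_upwards [condExp_sub hD'i hβ'i (pairSA Φ r g i n i' n')] with z hz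
    rw [Pi.sub_apply, condExp_of_stronglyMeasurable hmA hβ'sm hβ'i] at hz
    exact hz
  have h12 : LG[ξ * ξ' | pairSA Φ r g i n i' n'] =ᵐ[LG] H := by
    filter_upwards [h1, h2] with z hz1 hz2
    rw [hz1, Pi.mul_apply, hz2]
  -- Step 2 (tower): `Γ = E[H | join]` a.e., hence `|Γ| ≤ E[|H| | join]` a.e.
  have hΓ : pairCondCovLG σ a₀ θ₀ u₀ Φ r g i n i' n' =ᵐ[LG] LG[H | joinSA Φ r i n i' n'] := by
    have h0 : pairCondCovLG σ a₀ θ₀ u₀ Φ r g i n i' n' = LG[ξ * ξ' | joinSA Φ r i n i' n'] := rfl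
    rw [h0]
    exact (condExp_condExp_of_le (joinSA_le_pairSA Φ r g i n i' n') hmA).symm.trans (condExp_congr_ae h12)
  have hΓabs : ∀ᵐ z ∂LG, |pairCondCovLG σ a₀ θ₀ u₀ Φ r g i n i' n' z| ≤
      (LG[(fun z => |H z|) | joinSA Φ r i n i' n']) z := by
    filter_upwards [hΓ, abs_condExp_ae_le_condExp_abs (μ := LG) (m := joinSA Φ r i n i' n') H] with z hz1 hz2
    rw [hz1]
    exact hz2
  -- Step 3: integrate against the bounded join-measurable indicator
  have hSm : MeasurableSet[joinSA Φ r i n i' n'] (validEv Φ τ r i n ∩ validEv Φ τ r i' n' ∩ ordEv Φ r i n i' n') :=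
    measurableSet_vvo_joinSA Φ τ r i n i' n'
  have hIsm : StronglyMeasurable[joinSA Φ r i n i' n'] I := stronglyMeasurable_const.indicator hSm
  have hIm : Measurable I := measurable_const.indicator (hm _ hSm)
  have hI0 : ∀ z, 0 ≤ I z := fun z => Set.indicator_nonneg (fun _ _ => zero_le_one) z
  have hIb : ∀ z, |I z| ≤ 1 := fun z => by
    rw [abs_of_nonneg (hI0 z)]
    exact Set.indicator_le_self' (fun _ _ => zero_le_one) z
  have hIbn : ∀ᵐ z ∂LG, ‖I z‖ ≤ 1 := Eventually.of_forall fun z => by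
    rw [Real.norm_eq_abs]
    exact hIb z
  have hIΓi : Integrable (fun z => I z * |pairCondCovLG σ a₀ θ₀ u₀ Φ r g i n i' n' z|) LG :=
    Integrable.bdd_mul (c := 1)
      (integrable_condExp : Integrable (pairCondCovLG σ a₀ θ₀ u₀ Φ r g i n i' n') LG).abs
      hIm.aestronglyMeasurable hIbn
  have hIEi : Integrable (fun z => I z * (LG[(fun z => |H z|) | joinSA Φ r i n i' n']) z) LG :=
    Integrable.bdd_mul (c := 1) integrable_condExp hIm.aestronglyMeasurable hIbn
  have hIHi : Integrable (fun z => I z * |H z|) LG := Integrable.bdd_mul (c := 1) hHi.abs hIm.aestronglyMeasurable hIbn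
  have hIΔi : Integrable (fun z => I z * (4 * C * |β₂ z - β' z|)) LG :=
    Integrable.bdd_mul (c := 1) (((integrable_condExp : Integrable β₂ LG).sub hβ'i).abs.const_mul _)
      hIm.aestronglyMeasurable hIbn
  calc ∫ z, I z * |pairCondCovLG σ a₀ θ₀ u₀ Φ r g i n i' n' z| ∂LG
      ≤ ∫ z, I z * (LG[(fun z => |H z|) | joinSA Φ r i n i' n']) z ∂LG :=
        integral_mono_ae hIΓi hIEi (hΓabs.mono fun z hz => mul_le_mul_of_nonneg_left hz (hI0 z))
    _ = ∫ z, I z * |H z| ∂LG := (integral_mul_eq_integral_mul_condExp hm hIsm hIb hHi.abs).symm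
    _ ≤ ∫ z, I z * (4 * C * |β₂ z - β' z|) ∂LG :=
        integral_mono_ae hIHi hIΔi (hHb.mono fun z hz => mul_le_mul_of_nonneg_left hz (hI0 z))
    _ = 4 * C * ∫ z, I z * |β₂ z - β' z| ∂LG := by
        rw [← integral_const_mul]
        exact integral_congr_ae (Eventually.of_forall fun z => by ring)

/-- **B2′ ⟹ B2″ at fixed `N`.** For `σ ≤ 1/2`, a finite local Gibbs law, continuous `|g| ≤ C` and `0 ≤ δ`: if the B2′
integrand has `LG`-integral `≤ δ`, the B2″ integrand has `LG`-integral `≤ 4C δ`. Truncate both collision indices at `M`;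
a.e. the truncated sum is the finite family sum (`famSum_eq_truncPairSum`), whose integral is bounded pair by pair by the
tower step and then by the full B2′ integrand (`pairSum_ordered_le`); let `M → ∞` (monotone convergence). [folklore] -/
theorem lintegral_pairCondCov_le_of_innovation (hσ2 : σ ≤ 1 / 2) (Φ : Flow σ N)
    [IsFiniteMeasure (localGibbsLaw σ a₀ u₀ θ₀ N Φ)] (τ r : ℝ) {g : V3 × V3 × V3 → ℝ} (hg : Continuous g)
    {C : ℝ} (hC : ∀ p, |g p| ≤ C) {δ : ℝ} (hδ : 0 ≤ δ)
    (H : ∫⁻ z, ENNReal.ofReal ((hsDiameter σ N / ((N : ℝ) + 1)) ^ 2 *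
        ∑ i : Fin (N + 1), ∑ n ∈ Finset.range (cnt Φ τ z i),
          ∑ i' : Fin (N + 1), ∑ n' ∈ Finset.range (cnt Φ τ z i'),
            (if Precedes (past Φ r z i n) (past Φ r z i' n') then (1 : ℝ) else 0) *
              |betaLG2 σ a₀ θ₀ u₀ Φ r g i n i' n' z - betaLG σ a₀ θ₀ u₀ Φ r g i' n' z|)
        ∂(localGibbsLaw σ a₀ u₀ θ₀ N Φ) ≤ ENNReal.ofReal δ) :
    ∫⁻ z, ENNReal.ofReal ((hsDiameter σ N / ((N : ℝ) + 1)) ^ 2 *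
        ∑ i : Fin (N + 1), ∑ n ∈ Finset.range (cnt Φ τ z i),
          ∑ i' : Fin (N + 1), ∑ n' ∈ Finset.range (cnt Φ τ z i'),
            (if Precedes (past Φ r z i n) (past Φ r z i' n') then (1 : ℝ) else 0) *
              |pairCondCovLG σ a₀ θ₀ u₀ Φ r g i n i' n' z|)
        ∂(localGibbsLaw σ a₀ u₀ θ₀ N Φ) ≤ ENNReal.ofReal (4 * C * δ) := by
  set LG := localGibbsLaw σ a₀ u₀ θ₀ N Φ with hLG
  set c : ℝ := hsDiameter σ N / ((N : ℝ) + 1) with hc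
  have hC0 : 0 ≤ C := (abs_nonneg _).trans (hC 0)
  set Γ : Fin (N + 1) → ℕ → Fin (N + 1) → ℕ → Phase N → ℝ := pairCondCovLG σ a₀ θ₀ u₀ Φ r g with hΓ
  have haecut := ae_forall_lt_cnt_iff_pastTime (a₀ := a₀) (θ₀ := θ₀) (u₀ := u₀) hσ2 Φ τ r
  -- integrability of the family terms (bounded indicator times an integrable conditional expectation)
  have hSm : ∀ (i : Fin (N + 1)) (n : ℕ) (i' : Fin (N + 1)) (n' : ℕ),
      MeasurableSet (validEv Φ τ r i n ∩ validEv Φ τ r i' n' ∩ ordEv Φ r i n i' n') := fun i n i' n' =>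
    joinSA_le Φ r i n i' n' _ (measurableSet_vvo_joinSA Φ τ r i n i' n')
  have hIbn : ∀ k l : Fin (N + 1) × ℕ, ∀ᵐ z ∂LG,
      ‖(validEv Φ τ r k.1 k.2 ∩ validEv Φ τ r l.1 l.2 ∩ ordEv Φ r k.1 k.2 l.1 l.2).indicator (fun _ => (1 : ℝ)) z‖ ≤ 1 :=
    fun k l => Eventually.of_forall fun z => by
      rw [Real.norm_eq_abs, abs_of_nonneg (Set.indicator_nonneg (fun _ _ => zero_le_one) _)]
      exact Set.indicator_le_self' (fun _ _ => zero_le_one) z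
  have hTΓi : ∀ k l : Fin (N + 1) × ℕ, Integrable (fun z =>
      (validEv Φ τ r k.1 k.2 ∩ validEv Φ τ r l.1 l.2 ∩ ordEv Φ r k.1 k.2 l.1 l.2).indicator (fun _ => (1 : ℝ)) z *
        |Γ k.1 k.2 l.1 l.2 z|) LG := fun k l =>
    Integrable.bdd_mul (c := 1) (integrable_condExp : Integrable (Γ k.1 k.2 l.1 l.2) LG).abs
      (measurable_const.indicator (hSm k.1 k.2 l.1 l.2)).aestronglyMeasurable (hIbn k l)
  have hTΔi : ∀ k l : Fin (N + 1) × ℕ, Integrable (fun z =>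
      (validEv Φ τ r k.1 k.2 ∩ validEv Φ τ r l.1 l.2 ∩ ordEv Φ r k.1 k.2 l.1 l.2).indicator (fun _ => (1 : ℝ)) z *
        |betaLG2 σ a₀ θ₀ u₀ Φ r g k.1 k.2 l.1 l.2 z - betaLG σ a₀ θ₀ u₀ Φ r g l.1 l.2 z|) LG := fun k l =>
    Integrable.bdd_mul (c := 1) ((integrable_condExp : Integrable (betaLG2 σ a₀ θ₀ u₀ Φ r g k.1 k.2 l.1 l.2) LG).sub
      (integrable_condExp : Integrable (betaLG σ a₀ θ₀ u₀ Φ r g l.1 l.2) LG)).abs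
      (measurable_const.indicator (hSm k.1 k.2 l.1 l.2)).aestronglyMeasurable (hIbn k l)
  -- for each truncation level: the truncated B2″ integrand is a.e. a family sum, and its integral is `≤ 4Cδ`
  have hM : ∀ M : ℕ, AEMeasurable (fun z => ENNReal.ofReal (c ^ 2 * truncPairSum Φ τ r Γ M z)) LG ∧
      ∫⁻ z, ENNReal.ofReal (c ^ 2 * truncPairSum Φ τ r Γ M z) ∂LG ≤ ENNReal.ofReal (4 * C * δ) := by
    intro M
    set FΓ : Phase N → ℝ := fun z => c ^ 2 * ∑ k : Fin (N + 1) × Fin M, ∑ l : Fin (N + 1) × Fin M,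
      (validEv Φ τ r k.1 k.2 ∩ validEv Φ τ r l.1 l.2 ∩ ordEv Φ r k.1 k.2 l.1 l.2).indicator (fun _ => (1 : ℝ)) z *
        |Γ k.1 k.2 l.1 l.2 z| with hFΓ
    set FΔ : Phase N → ℝ := fun z => c ^ 2 * ∑ k : Fin (N + 1) × Fin M, ∑ l : Fin (N + 1) × Fin M,
      (validEv Φ τ r k.1 k.2 ∩ validEv Φ τ r l.1 l.2 ∩ ordEv Φ r k.1 k.2 l.1 l.2).indicator (fun _ => (1 : ℝ)) z *
        |betaLG2 σ a₀ θ₀ u₀ Φ r g k.1 k.2 l.1 l.2 z - betaLG σ a₀ θ₀ u₀ Φ r g l.1 l.2 z| with hFΔ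
    have hFΓi : Integrable FΓ LG :=
      (integrable_finsetSum _ fun k _ => integrable_finsetSum _ fun l _ => hTΓi (k.1, k.2) (l.1, l.2)).const_mul _
    have hFΔi : Integrable FΔ LG :=
      (integrable_finsetSum _ fun k _ => integrable_finsetSum _ fun l _ => hTΔi (k.1, k.2) (l.1, l.2)).const_mul _
    have hFΓ0 : ∀ z, 0 ≤ FΓ z := fun z => mul_nonneg (sq_nonneg _) (Finset.sum_nonneg fun k _ =>
      Finset.sum_nonneg fun l _ => mul_nonneg (Set.indicator_nonneg (fun _ _ => zero_le_one) _) (abs_nonneg _))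
    have hFΔ0 : ∀ z, 0 ≤ FΔ z := fun z => mul_nonneg (sq_nonneg _) (Finset.sum_nonneg fun k _ =>
      Finset.sum_nonneg fun l _ => mul_nonneg (Set.indicator_nonneg (fun _ _ => zero_le_one) _) (abs_nonneg _))
    -- (i) the truncated integrand is the `Γ` family sum a.e. (genuine cut)
    have htrunc : ∀ᵐ z ∂LG, c ^ 2 * truncPairSum Φ τ r Γ M z = FΓ z := by
      filter_upwards [haecut] with z hz
      rw [hFΓ, ← famSum_eq_truncPairSum Φ τ r Γ M hz]
    -- (ii) pair by pair, the tower step: `∫ FΓ ≤ 4C ∫ FΔ`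
    have hint : ∫ z, FΓ z ∂LG ≤ 4 * C * ∫ z, FΔ z ∂LG := by
      simp only [hFΓ, hFΔ]
      rw [integral_const_mul, integral_const_mul, mul_left_comm]
      refine mul_le_mul_of_nonneg_left ?_ (sq_nonneg _)
      rw [integral_finsetSum _ fun k _ => integrable_finsetSum _ fun l _ => hTΓi (k.1, k.2) (l.1, l.2),
        integral_finsetSum _ fun k _ => integrable_finsetSum _ fun l _ => hTΔi (k.1, k.2) (l.1, l.2), Finset.mul_sum]
      refine Finset.sum_le_sum fun k _ => ?_
      rw [integral_finsetSum _ fun l _ => hTΓi (k.1, k.2) (l.1, l.2),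
        integral_finsetSum _ fun l _ => hTΔi (k.1, k.2) (l.1, l.2), Finset.mul_sum]
      exact Finset.sum_le_sum fun l _ => integral_vvo_abs_pairCondCovLG_le hσ2 Φ τ r hg hC k.1 k.2 l.1 l.2
    -- (iii) the B2′ family sum is dominated by the full B2′ integrand a.e. (genuine cut), so `∫ FΔ ≤ δ`
    have hFΔle : ∫ z, FΔ z ∂LG ≤ δ :=
      integral_le_of_lintegral_ofReal_le (ae_of_all _ hFΔ0) hFΔi.aestronglyMeasurable
        (haecut.mono fun z hz => mul_le_mul_of_nonneg_left (pairSum_ordered_le Φ τ r g M hz) (sq_nonneg _)) H hδ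
    refine ⟨(hFΓi.aestronglyMeasurable.aemeasurable.ennreal_ofReal).congr
      (htrunc.mono fun z hz => (congrArg ENNReal.ofReal hz).symm), ?_⟩
    calc ∫⁻ z, ENNReal.ofReal (c ^ 2 * truncPairSum Φ τ r Γ M z) ∂LG = ∫⁻ z, ENNReal.ofReal (FΓ z) ∂LG :=
          lintegral_congr_ae (htrunc.mono fun z hz => congrArg ENNReal.ofReal hz)
      _ = ENNReal.ofReal (∫ z, FΓ z ∂LG) := (ofReal_integral_eq_lintegral_ofReal hFΓi (ae_of_all _ hFΓ0)).symm
      _ ≤ ENNReal.ofReal (4 * C * δ) :=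
          ENNReal.ofReal_le_ofReal (hint.trans (mul_le_mul_of_nonneg_left hFΔle (by positivity)))
  -- `M → ∞`: the truncated integrands increase to the B2″ integrand pointwise (eventually equal)
  have hmono : ∀ z : Phase N, Monotone fun M : ℕ => ENNReal.ofReal (c ^ 2 * truncPairSum Φ τ r Γ M z) :=
    fun z M M' hMM' => ENNReal.ofReal_le_ofReal
      (mul_le_mul_of_nonneg_left (truncPairSum_mono Φ τ r Γ z hMM') (sq_nonneg _))
  have htend : ∀ z : Phase N, Tendsto (fun M : ℕ => ENNReal.ofReal (c ^ 2 * truncPairSum Φ τ r Γ M z)) atTop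
      (𝓝 (ENNReal.ofReal (c ^ 2 * ∑ i : Fin (N + 1), ∑ n ∈ Finset.range (cnt Φ τ z i),
          ∑ i' : Fin (N + 1), ∑ n' ∈ Finset.range (cnt Φ τ z i'),
            (if Precedes (past Φ r z i n) (past Φ r z i' n') then (1 : ℝ) else 0) * |Γ i n i' n' z|))) := by
    intro z
    refine tendsto_atTop_of_eventually_const (i₀ := Finset.univ.sup (cnt Φ τ z)) fun M hM => ?_
    rw [truncPairSum_eq_of_sup_le Φ τ r Γ z hM]
  exact le_of_tendsto' (lintegral_tendsto_of_tendsto_of_monotone (fun M => (hM M).1)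
    (Eventually.of_forall hmono) (Eventually.of_forall htend)) fun M => (hM M).2

end FixedN

/-! ## The registered sub-goal -/

/-- **B2′ ⟹ B2″ — `pairCondCov_of_pairInnovationBias` (registered sub-goal of the line `condition-the-past`).**
The pair innovation statement `PairInnovationBias rs` (B2′) implies the pair conditional covariance statement
`PairCondCov rs` (B2″), with `σ₀ := min σ₀ (1/2)` and, for a target `δ`, the B2′ threshold at `δ/(4C+1)` (`C` the bound
of `g`): at each `N ≥ N₀` apply `lintegral_pairCondCov_le_of_innovation` (tower property on the join of the two pasts,
truncation of the random index ranges, monotone convergence). [folklore] -/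
theorem pairCondCov_of_pairInnovationBias : PairInnovationBias rs → PairCondCov rs := by
  intro hB2 a₀ θ₀ u₀ ha hθ hu ha0 hθ0
  obtain ⟨σ₁, hσ₁, H⟩ := hB2 a₀ θ₀ u₀ ha hθ hu ha0 hθ0
  refine ⟨min σ₁ (1 / 2), lt_min hσ₁ (by norm_num), ?_⟩
  intro σ hσ hσlt Φ τ hτ g hg hgb δ hδ
  have hσ1 : σ < σ₁ := hσlt.trans_le (min_le_left _ _)
  have hσ2 : σ ≤ 1 / 2 := (hσlt.trans_le (min_le_right _ _)).le
  obtain ⟨C, hC⟩ := hgb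
  have hC0 : 0 ≤ C := (abs_nonneg _).trans (hC 0)
  have hδ' : 0 < δ / (4 * C + 1) := by positivity
  obtain ⟨N₀, hN₀⟩ := H σ hσ hσ1 Φ τ hτ g hg ⟨C, hC⟩ (δ / (4 * C + 1)) hδ'
  refine ⟨N₀, fun N hN => ?_⟩
  haveI : IsProbabilityMeasure (localGibbsLaw σ a₀ u₀ θ₀ N (Φ N)) :=
    isProbabilityMeasure_localGibbsLaw ha hθ hu ha0 hθ0 hσ2 N (Φ N)
  refine (lintegral_pairCondCov_le_of_innovation hσ2 (Φ N) τ (rs N) hg hC hδ'.le (hN₀ N hN)).trans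
    (ENNReal.ofReal_le_ofReal ?_)
  rw [mul_div_assoc', div_le_iff₀ (by positivity)]
  nlinarith

end Summit.AtomisticToContinuum.HydrodynamicLimit.Theorems.KickFairRelEquilibriumMesoLine

end
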